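import Summits.BirchSwinnertonDyer.BirchSwinnertonDyer.Theorems.ErratumRoadFiveBoundedCongruenceLimitEndForm
import Summits.BirchSwinnertonDyer.BirchSwinnertonDyer.Theorems.ErratumRoadFiveSelmerControlDefect
import Summits.BirchSwinnertonDyer.BirchSwinnertonDyer.Theorems.ErratumRoadFivePontryaginDefect
import Summits.BirchSwinnertonDyer.Rank1Residual.X11b.CastellaErratumSelmerCongruence
import HarnessLib

/-!
# Route `ErratumRoadFive` (K2, `p ≥ 5`), crux (T) `Rest3TorsionBranchAtFive` (item
# stmt-BirchSwinnertonDyer-19702): THEOREM T♭ — erratum Thm. 1.1 WITHOUT (iv), ONE-SIDED, KERNEL FORM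
# at the Selmer level: `Ch_Λ(Sel(M_f)^∨) ⊆ (L)` from congruent Galois modules whose LOCAL invariants are
# killed by `π^k` (no local vanishing), assembled into g13's bounded-kernel end form (glue (G1) of §32.8)

Cell `bsd-stepL` (run/shared/lean/pub/bsd-stepL/), seat `bsd-stepL-bdp` (prover g14, 2026-08-26), memo
`HOME/proof/PROOF-BDP.md` §31.3 / §32.8–32.9; `--supports stmt-BirchSwinnertonDyer-19702 --as helper`.
The (iv)-free analogue of multr1-p1's `TorsionControl.powerSeries_isTorsion_and_charIdeal_eq_of_selmer_congruences_printed`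
(`X11b/CastellaErratumSelmerCongruence.lean`): there, hypotheses `hlocf`/`hlocg` (`H⁰(Γ_v, M) = 0`, i.e.
erratum (iv)) make `Sel(M[a^m]) ≅ Sel(M)[a^m]` and the congruence modules ISOMORPHIC; here the local
invariants are only assumed KILLED BY `π^k` (uniformly in `m`) — which on branch (T) is Lemma (L1)
(`ErratumRoadFiveTateTorsionRigidity*.lean`: `H⁰(K_𝔭, M_E) = ⊕_w E(K_{∞,w})[p^∞] ⊗ 𝒪`, killed by `p^k`) —
and the conclusion is the ONE-SIDED inclusion `Fitt = Ch ⊆ (L)` of the route.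

HONEST FRAMING: theorems only (no definition, no named fact, no `sorry`); PURE ALGEBRA on abstract Selmer
data (multr1-p1's `ContinuousRep`/`selmer` currency) — the arithmetic objects (`G_{K,S}`, `M_E`, `M_{g_m}`,
the erratum's inputs (a)(b)(c), FW21 4.41, Lemma 2.2) are NOT constructed or asserted; one residual
hypothesis `hgen` = (G2) of §32.8 (the generator bound of the dual defect, which in the application
follows from the FINITENESS of `𝒪/ϖ` and of `H⁰(K_𝔭, M_{g_m})[ϖ^m]`; memo §32.9). Nothing is booked; no
census word, tier or label moves (T7).

## Statement (`powerSeries_charIdeal_le_of_selmer_congruences_boundedDefect`)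

Data over `Λ = 𝒪⟦T⟧` (`𝒪` a complete DVR), `a ∈ Λ` in the Jacobson radical, Selmer data `(Γ, φ_v, L)`:
`M_f`, `M_{g_m}` discrete `Λ`-linear `Γ`-modules, `a`-divisible, with `H⁰(Γ, ·) = 0` (irreducibility) —
NO `H⁰(Γ_v, ·) = 0`; instead `hkillg : π^k · M_{g_m}^{Γ_v} = 0` for `v ∈ L`, all `m`; (b) `θ_m :
M_{g_m}[a^m] ≅ M_f[a^m]`; `X = Sel(M_f)^∨`, `X_m = Sel(M_{g_m})^∨` finitely generated; `hCh : Ch(X_m) ⊆ (L_m)`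
when torsion (Thm. 2.3 ⇐ FW21 4.41, as a binder); `hc : (L_m) + (a)^m = (L) + (a)^m` ((c)); `hT`, `hnf` on `X`
(torsion, no finite submodule: JSW17 control + Lemma 2.2); `π` prime with `π ∤ L` (`μ = 0`, §31.3 (7));
`hgen` (G2). CONCLUSION: `Fitt_Λ(X) = Ch_Λ(X) ⊆ (L)`.

Proof = assembly: `Q_m := Sel(M_f[a^m])^∨`, `α_m := (Sel(M_f[a^m]) ↪ Sel(M_f))^∨` (surjective: Lemma 2.1's
injectivity needs only `H⁰(Γ, M_f) = 0`); `N_m/(a)^m = X_m/(a)^m ≃ (Sel(M_{g_m})[a^m])^∨`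
(`PontryaginCongruence`); `j_m : Sel(M_{g_m}[a^m]) ↪ Sel(M_{g_m})[a^m]` with cokernel killed by `π^k`
(`SelmerControlDefect.smul_mem_map_selmer_pow`), dualised by `PontryaginDefect.exact_dual_conj` into
`Kd_m := (coker j_m)^∨ → X_m/(a)^m ↠ Q_m` exact with `π^k · Kd_m = 0`; then
`BoundedCongruenceLimit.charIdeal_le_span_of_congruences_boundedKernel`.

References: [Castella2018Erratum] Lemma 2.1, proof of Thm. 1.1 (p. 4); memo PROOF-BDP §31.2–31.3, §32.8–32.9.
-/

set_option autoImplicit false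
-- the Theorems namespace of this sub repeats the summit name by design (D-0017 nested layout)
set_option linter.dupNamespace false

noncomputable section

open CategoryTheory CharacterModule Literature.NumberTheory.GaloisRepresentations
  Literature.RingTheory.FittingIdeal Literature.NumberTheory.EllipticCurves
  Literature.NumberTheory.EllipticCurves.Module
  Summit.BirchSwinnertonDyer.Rank1Residual.X11b.TorsionControl
  Summit.BirchSwinnertonDyer.Rank1Residual.X11b
  Summit.BirchSwinnertonDyer.BirchSwinnertonDyer.Theorems.SelmerControlDefect
  Summit.BirchSwinnertonDyer.BirchSwinnertonDyer.Theorems.PontryaginDefect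
open scoped ContRepresentation

namespace Summit.BirchSwinnertonDyer.BirchSwinnertonDyer.Theorems.SelmerDefectAssembly

/-! ### §1 Two transport lemmas along an equality of submodules -/

section Transport

variable {R : Type*} [CommRing R] {P S : Type*} [AddCommGroup P] [Module R P] [AddCommGroup S]
  [Module R S]

/-- `exact_dual_mkQ_dual` with the range replaced by an EQUAL submodule `U`. [folklore] -/
theorem exact_dual_mkQ_dual_of_eq (j : P →ₗ[R] S) (U : Submodule R S) (hU : LinearMap.range j = U) :
    Function.Exact (dual U.mkQ) (dual j) := by
  subst hU
  exact exact_dual_mkQ_dual j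

/-- `exact_dual_conj` with the range replaced by an EQUAL submodule `U`. [folklore] -/
theorem exact_dual_conj_of_eq (j : P →ₗ[R] S) (U : Submodule R S) (hU : LinearMap.range j = U)
    {N' Q : Type*} [AddCommGroup N'] [Module R N'] [AddCommGroup Q] [Module R Q]
    (eS : N' ≃ₗ[R] CharacterModule S) (eP : CharacterModule P ≃ₗ[R] Q) :
    Function.Exact ((eS.symm : CharacterModule S →ₗ[R] N') ∘ₗ dual U.mkQ)
      ((eP : CharacterModule P →ₗ[R] Q) ∘ₗ dual j ∘ₗ (eS : N' →ₗ[R] CharacterModule S)) := by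
  subst hU
  exact exact_dual_conj j eS eP

end Transport

/-! ### §2 The assembly over `Λ_𝒪 = 𝒪⟦T⟧` -/

section Assembly

variable {𝒪 : Type} [CommRing 𝒪] [IsDomain 𝒪] [IsDiscreteValuationRing 𝒪]
  [IsAdicComplete (IsLocalRing.maximalIdeal 𝒪) 𝒪] [TopologicalSpace (PowerSeries 𝒪)]
variable {Γ₀ : Type} [Group Γ₀] [TopologicalSpace Γ₀] [IsTopologicalGroup Γ₀]
variable {ι₀ : Type*} {Γw : ι₀ → Type} [∀ v, Group (Γw v)] [∀ v, TopologicalSpace (Γw v)]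
  [∀ v, IsTopologicalGroup (Γw v)] (ψ : ∀ v, Γw v →ₜ* Γ₀) (L₀ : Set ι₀)

/-- **THEOREM T♭, one-sided, kernel form at the Selmer level** (see the module docstring for the
dictionary and the honest framing). Over `Λ = 𝒪⟦T⟧`: from `a`-divisible congruent discrete Galois modules
`M_f`, `M_{g_m}` with vanishing GLOBAL invariants, local invariants of the `M_{g_m}` killed by `π^k`
uniformly (NO local vanishing), `Ch(X_m) ⊆ (L_m)`, `(L_m) + (a)^m = (L) + (a)^m`, `X = Sel(M_f)^∨` torsion
without finite submodules, `π ∤ L`, and the generator bound `hgen` on the dual defects, conclude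
**`Fitt_Λ(X) = Ch_Λ(X) ⊆ (L)`**. [cite: Castella2018Erratum, proof of Thm. 1.1 (p. 4), read one-sidedly and without (iv)] -/
theorem powerSeries_charIdeal_le_of_selmer_congruences_boundedDefect
    (a : PowerSeries 𝒪) (ha : Ideal.span {a} ≤ (⊥ : Ideal (PowerSeries 𝒪)).jacobson)
    {Mf : Type} [AddCommGroup Mf] [Module (PowerSeries 𝒪) Mf] [TopologicalSpace Mf]
    [DiscreteTopology Mf] [ContinuousSMul (PowerSeries 𝒪) Mf] (ρf : ContinuousRep Γ₀ (PowerSeries 𝒪) Mf)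
    (hdivf : Function.Surjective fun x : Mf => a • x) (h0f : ρf.toTopRep.ρ.invariants = ⊥)
    (Mg : ℕ → Type) [∀ m, AddCommGroup (Mg m)] [∀ m, Module (PowerSeries 𝒪) (Mg m)]
    [∀ m, TopologicalSpace (Mg m)] [∀ m, DiscreteTopology (Mg m)]
    [∀ m, ContinuousSMul (PowerSeries 𝒪) (Mg m)] (ρg : ∀ m, ContinuousRep Γ₀ (PowerSeries 𝒪) (Mg m))
    (hdivg : ∀ m, Function.Surjective fun x : Mg m => a • x)
    (h0g : ∀ m, (ρg m).toTopRep.ρ.invariants = ⊥)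
    (θ : ∀ m, 1 ≤ m → ((torsionRep (ρg m) (a ^ m)).toTopRep ≅ (torsionRep ρf (a ^ m)).toTopRep))
    [Module.Finite (PowerSeries 𝒪) (CharacterModule (selmer ψ L₀ ρf))]
    [∀ m, Module.Finite (PowerSeries 𝒪) (CharacterModule (selmer ψ L₀ (ρg m)))]
    {π L : PowerSeries 𝒪} (hπ : Prime π) (hL : ¬ π ∣ L) (k n : ℕ) (Lm : ℕ → PowerSeries 𝒪)
    (hkillg : ∀ m, ∀ v ∈ L₀, ∀ w : Mg m,
      w ∈ (((ρg m).restrict (ψ v)).toTopRep).ρ.invariants → π ^ k • w = 0)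
    (hgen : ∀ m, 1 ≤ m → ∃ κ : Fin n → CharacterModule
      (↥(Submodule.torsionBy (PowerSeries 𝒪) ↥(selmer ψ L₀ (ρg m)) (a ^ m)) ⧸
        Submodule.comap ((selmer ψ L₀ (ρg m)).subtype ∘ₗ
            (Submodule.torsionBy (PowerSeries 𝒪) ↥(selmer ψ L₀ (ρg m)) (a ^ m)).subtype)
          (Submodule.map (torsionInclH1 (ρg m) (a ^ m)) (selmer ψ L₀ (torsionRep (ρg m) (a ^ m))))),
      Submodule.span (PowerSeries 𝒪) (Set.range κ) = ⊤)
    (hCh : ∀ m, 1 ≤ m → Module.IsTorsion (PowerSeries 𝒪) (CharacterModule (selmer ψ L₀ (ρg m))) →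
      charIdeal (PowerSeries 𝒪) (CharacterModule (selmer ψ L₀ (ρg m))) ≤ Ideal.span {Lm m})
    (hc : ∀ m, 1 ≤ m → Ideal.span {Lm m} ⊔ (Ideal.span {a}) ^ m = Ideal.span {L} ⊔ (Ideal.span {a}) ^ m)
    (hT : Module.IsTorsion (PowerSeries 𝒪) (CharacterModule (selmer ψ L₀ ρf)))
    (hnf : ∀ N' : Submodule (PowerSeries 𝒪) (CharacterModule (selmer ψ L₀ ρf)),
      Module.length (PowerSeries 𝒪) N' ≠ ⊤ → N' = ⊥) :
    Module.fittingIdeal (PowerSeries 𝒪) (CharacterModule (selmer ψ L₀ ρf)) 0 =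
        charIdeal (PowerSeries 𝒪) (CharacterModule (selmer ψ L₀ ρf)) ∧
      charIdeal (PowerSeries 𝒪) (CharacterModule (selmer ψ L₀ ρf)) ≤ Ideal.span {L} := by
  -- f-side: `j^f_m : Sel(M_f[a^m]) ↪ Sel(M_f)`, `Q_m := Sel(M_f[a^m])^∨`, `α_m := (j^f_m)^∨` surjective
  let jf : ∀ m : ℕ, ↥(selmer ψ L₀ (torsionRep ρf (a ^ m))) →ₗ[PowerSeries 𝒪] ↥(selmer ψ L₀ ρf) :=
    fun m => LinearMap.codRestrict (selmer ψ L₀ ρf)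
      ((torsionInclH1 ρf (a ^ m)).domRestrict (selmer ψ L₀ (torsionRep ρf (a ^ m))))
      fun x => cohomologyMap_mem_selmer ψ L₀ (torsionIncl ρf (a ^ m)) x.2
  have hjf : ∀ m, Function.Injective (jf m) := by
    intro m x x' h
    have h1 := congrArg Subtype.val h
    exact Subtype.ext (cohomologyMap_torsionIncl_injective ρf (a ^ m) (surjective_pow_smul a hdivf m)
      (invariants_divisible_of_eq_bot ρf (a ^ m) h0f) h1)
  haveI : ∀ m, Module.Finite (PowerSeries 𝒪) (CharacterModule ↥(selmer ψ L₀ (torsionRep ρf (a ^ m)))) :=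
    fun m => Module.Finite.of_surjective (dual (jf m)) (dual_surjective_of_injective (jf m) (hjf m))
  -- g-side: `S_m := Sel(M_{g_m})[a^m]`, `j_m : Sel(M_{g_m}[a^m]) ↪ S_m`, its range `U_m`
  let Sg : ∀ m : ℕ, Submodule (PowerSeries 𝒪) ↥(selmer ψ L₀ (ρg m)) :=
    fun m => Submodule.torsionBy (PowerSeries 𝒪) ↥(selmer ψ L₀ (ρg m)) (a ^ m)
  let jg : ∀ m : ℕ, ↥(selmer ψ L₀ (torsionRep (ρg m) (a ^ m))) →ₗ[PowerSeries 𝒪] ↥(Sg m) :=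
    fun m => LinearMap.codRestrict (Sg m)
      (LinearMap.codRestrict (selmer ψ L₀ (ρg m))
        ((torsionInclH1 (ρg m) (a ^ m)).domRestrict (selmer ψ L₀ (torsionRep (ρg m) (a ^ m))))
        fun x => cohomologyMap_mem_selmer ψ L₀ (torsionIncl (ρg m) (a ^ m)) x.2)
      fun x => (Submodule.mem_torsionBy_iff (a ^ m) _).2
        (Subtype.ext (smul_cohomologyMap_torsionIncl (ρg m) (a ^ m) x.1))
  have hjg : ∀ m, Function.Injective (jg m) := by
    intro m x x' h
    have h1 : (((jg m x : ↥(Sg m)) : ↥(selmer ψ L₀ (ρg m))) : continuousCohomology 1 (ρg m).toTopRep) =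
        (((jg m x' : ↥(Sg m)) : ↥(selmer ψ L₀ (ρg m))) : continuousCohomology 1 (ρg m).toTopRep) := by
      rw [h]
    exact Subtype.ext (cohomologyMap_torsionIncl_injective (ρg m) (a ^ m) (surjective_pow_smul a (hdivg m) m)
      (invariants_divisible_of_eq_bot (ρg m) (a ^ m) (h0g m)) h1)
  let U : ∀ m : ℕ, Submodule (PowerSeries 𝒪) ↥(Sg m) := fun m =>
    Submodule.comap ((selmer ψ L₀ (ρg m)).subtype ∘ₗ (Sg m).subtype)
      (Submodule.map (torsionInclH1 (ρg m) (a ^ m)) (selmer ψ L₀ (torsionRep (ρg m) (a ^ m))))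
  have hU : ∀ m, LinearMap.range (jg m) = U m := by
    intro m
    ext s
    constructor
    · rintro ⟨x, rfl⟩
      exact ⟨x, x.2, rfl⟩
    · rintro ⟨x, hx, hxs⟩
      refine ⟨⟨x, hx⟩, Subtype.ext (Subtype.ext ?_)⟩
      exact hxs
  -- the dual defect `Kd_m := (S_m ⧸ U_m)^∨` is killed by `π^k` (Lemma 2.1♭ + (L1)-shaped input)
  have hkill : ∀ m, 1 ≤ m → π ^ k ∈ Module.annihilator (PowerSeries 𝒪)
      (CharacterModule (↥(Sg m) ⧸ U m)) := by
    intro m _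
    refine mem_annihilator_characterModule_of_forall_smul_eq_zero (π ^ k) fun q => ?_
    obtain ⟨s, rfl⟩ := Submodule.mkQ_surjective (U m) q
    rw [← map_smul, Submodule.mkQ_apply, Submodule.Quotient.mk_eq_zero]
    -- `π^k • s ∈ U_m` : the exponent bound of the control defect
    have hs : (a ^ m) • ((s : ↥(selmer ψ L₀ (ρg m))) : continuousCohomology 1 (ρg m).toTopRep) = 0 := by
      have := (Submodule.mem_torsionBy_iff (a ^ m) (s : ↥(selmer ψ L₀ (ρg m)))).1 s.2
      exact congrArg Subtype.val this
    exact smul_mem_map_selmer_pow ψ L₀ (ρg m) a (hdivg m) (π ^ k) (hkillg m) m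
      (s : ↥(selmer ψ L₀ (ρg m))).2 hs
  -- the isomorphisms `X_m/(a)^m ≃ S_m^∨` and `(Sel(M_{g_m}[a^m]))^∨ ≃ Q_m`
  let eS : ∀ m : ℕ, ((CharacterModule ↥(selmer ψ L₀ (ρg m)) ⧸
      (Ideal.span {a}) ^ m • (⊤ : Submodule (PowerSeries 𝒪) (CharacterModule ↥(selmer ψ L₀ (ρg m))))) ≃ₗ[PowerSeries 𝒪]
        CharacterModule ↥(Sg m)) :=
    fun m => Classical.choice (PontryaginCongruence.nonempty_quotIdealPow_equiv_dual_torsionBy a m)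
  let eP : ∀ m : ℕ, 1 ≤ m → (CharacterModule ↥(selmer ψ L₀ (torsionRep (ρg m) (a ^ m))) ≃ₗ[PowerSeries 𝒪]
      CharacterModule ↥(selmer ψ L₀ (torsionRep ρf (a ^ m)))) :=
    fun m hm => CharacterModule.congr (selmerCongr ψ L₀ (θ m hm))
  -- assemble into the bounded-kernel end form
  refine BoundedCongruenceLimit.charIdeal_le_span_of_congruences_boundedKernel
    (fun m => CharacterModule ↥(selmer ψ L₀ (ρg m)))
    (fun m => CharacterModule ↥(selmer ψ L₀ (torsionRep ρf (a ^ m))))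
    (fun m => CharacterModule (↥(Sg m) ⧸ U m))
    (Ideal.span {a}) ha hπ hL k n Lm
    (fun m _ => dual (jf m)) (fun m _ => dual_surjective_of_injective (jf m) (hjf m))
    (fun m _ => ((eS m).symm : _ →ₗ[PowerSeries 𝒪] _) ∘ₗ dual (U m).mkQ)
    (fun m hm => ((eP m hm) : _ →ₗ[PowerSeries 𝒪] _) ∘ₗ dual (jg m) ∘ₗ ((eS m) : _ →ₗ[PowerSeries 𝒪] _))
    (fun m hm => exact_dual_conj_of_eq (jg m) (U m) (hU m) (eS m) (eP m hm))
    (fun m hm => dual_conj_surjective (jg m) (hjg m) (eS m) (eP m hm))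
    hgen hkill hCh hc hT hnf

end Assembly

end Summit.BirchSwinnertonDyer.BirchSwinnertonDyer.Theorems.SelmerDefectAssembly

end
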